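import Summits.PneNP.PneNP.Theorems.LatticeMagicTargetStubGameCombinatorics
import Literature.Computability.Complexity.PlumbingBricks
import Literature.Computability.Cryptography.CoinChunks

/-!
# `stub_game`, part 2/4: the predictor's run function as a pipeline of `FP` bricks

Card `kpt-squeeze-ideal-lattice-leg`, §First lemma: the run function of the hard-core-bit predictor
`A_{j₀}` written in the tree's `FP`-brick algebra (`BrickAlgebra.lean`, `PlumbingBricks.lean`):
reading `1ⁿ`, `y` and the coin blocks off `⟨⟨1ⁿ, y⟩, r⟩`, the images vector, bit extraction, the
wrongness test, the simulated teacher's revelation, the unrolled rounds (`entriesF`, `propF`) and the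
answer scan (`scanF`); polynomial time by the closure lemmas, one-bit outputs, and the values of all
bricks on well-formed inputs.

## References

* S. Arora, B. Barak, *Computational Complexity: A Modern Approach*, CUP 2009, §1.3, §7.1.
-/

set_option linter.dupNamespace false -- `Summit.PneNP.PneNP` is the mandated summit-side namespace

namespace Summit.PneNP.PneNP.Theorems.LatticeMagicTarget

open Literature.Computability.Complexity Literature.Computability.Cryptography
open _root_.Computability

namespace StubGame

variable {t : ℕ} (g : List Bool → List Bool) (B : List Bool → Bool) (S : List Bool → List Bool)

/-! ### 3. The predictor's run function as a pipeline of `FP` bricks -/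

section Bricks

open Literature.Computability.Complexity.Brick Literature.Computability.Complexity.Plumb
  Literature.Computability.Complexity.OracleCompose

variable (S Bb : List Bool → List Bool)

/-- `1ⁿ`, read off the machine input `⟨⟨1ⁿ, y⟩, r⟩`. -/
def unLenF : List Bool → List Bool := fstF ∘ fstF

/-- The image `y` under attack. -/
def imgInF : List Bool → List Bool := sndF ∘ fstF

/-- `1^{i n}`. -/
noncomputable def mulF : ℕ → List Bool → List Bool
  | 0 => fun _ => []
  | i + 1 => concatFn ∘ fanoutFn unLenF (mulF i)

/-- Block `i` of the coin string: `chunk n r i`. -/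
noncomputable def blkF (i : ℕ) : List Bool → List Bool :=
  takeFn ∘ fanoutFn unLenF (dropFn ∘ fanoutFn (mulF i) sndF)

/-- Image `i`: `y` at the planted coordinate `j₀`, else `g (u_i)`. -/
noncomputable def imgF (j₀ i : ℕ) : List Bool → List Bool := if i = j₀ then imgInF else g ∘ blkF i

/-- Nested pairing of the values of a list of bricks (the brick form of `flat`). -/
noncomputable def flatF : List (List Bool → List Bool) → List Bool → List Bool
  | [] => fun _ => []
  | f :: fs => fanoutFn f (flatF fs)

/-- The vector of images shown to the student. -/
noncomputable def imgsF (t j₀ : ℕ) : List Bool → List Bool :=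
  flatF (List.ofFn fun i : Fin t => imgF g j₀ i)

/-- Bit `i` (junk `false`) of the string computed by `V`, as a one-bit string. -/
noncomputable def bitAtF (i : ℕ) (V : List Bool → List Bool) : List Bool → List Bool :=
  eqPairFn ∘ fanoutFn
    (takeFn ∘ fanoutFn (fun _ => [true]) (dropFn ∘ fanoutFn (fun _ => unaryEncodeNat i) V))
    (fun _ => [true])

/-- "coordinate `i` of the proposal computed by `V` is wrong" (one bit). -/
noncomputable def wrongF (i : ℕ) (V : List Bool → List Bool) : List Bool → List Bool :=
  notFn (eqPairFn ∘ fanoutFn (Bb ∘ blkF i) (bitAtF i V))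

/-- The revealed pair `⟨1^i, u_i⟩`. -/
noncomputable def entryF (i : ℕ) : List Bool → List Bool :=
  fanoutFn (fun _ => unaryEncodeNat i) (blkF i)

/-- The simulated teacher's revelation: the first wrong listed coordinate (default `dd`). -/
noncomputable def selF (V : List Bool → List Bool) : List ℕ → ℕ → List Bool → List Bool
  | [], dd => entryF dd
  | i :: is, dd => iteFn (wrongF Bb i V) (entryF i) (selF V is dd)

/-- "all listed coordinates of the proposal computed by `V` are right" (one bit). -/
noncomputable def allRightF (V : List Bool → List Bool) : List ℕ → List Bool → List Bool
  | [] => fun _ => [true]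
  | i :: is => andFn (notFn (wrongF Bb i V)) (allRightF V is)

/-- The revealed entries of the first `r` rounds of the simulated play. -/
noncomputable def entriesF (cd : List ℕ) (dd : ℕ) (imgs : List Bool → List Bool) :
    ℕ → List (List Bool → List Bool)
  | 0 => []
  | r + 1 => entriesF cd dd imgs r ++
      [selF Bb (S ∘ fanoutFn imgs (flatF (entriesF cd dd imgs r))) cd dd]

/-- The proposal of round `r` of the simulated play. -/
noncomputable def propF (cd : List ℕ) (dd : ℕ) (imgs : List Bool → List Bool) (r : ℕ) :
    List Bool → List Bool :=
  S ∘ fanoutFn imgs (flatF (entriesF S Bb cd dd imgs r))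

/-- The answer: scanning rounds `r, …, r + m - 1`, the bit at `j₀` of the first proposal all of
whose listed coordinates are right (junk `[false]`). -/
noncomputable def scanF (cd : List ℕ) (dd : ℕ) (imgs : List Bool → List Bool) (j₀ : ℕ) :
    ℕ → ℕ → List Bool → List Bool
  | _, 0 => fun _ => [false]
  | r, m + 1 => iteFn (allRightF Bb (propF S Bb cd dd imgs r) cd) (bitAtF j₀ (propF S Bb cd dd imgs r))
      (scanF cd dd imgs j₀ (r + 1) m)

/-! #### Polynomial time -/

/-- `unLenF ∈ FP`. -/
theorem unLenF_mem_FP : unLenF ∈ FP := comp_mem_FP fstF_mem_FP fstF_mem_FP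

/-- `imgInF ∈ FP`. -/
theorem imgInF_mem_FP : imgInF ∈ FP := comp_mem_FP sndF_mem_FP fstF_mem_FP

/-- `mulF i ∈ FP`. -/
theorem mulF_mem_FP : ∀ i, mulF i ∈ FP
  | 0 => const_mem_FP _
  | i + 1 => comp_mem_FP concatFn_mem_FP (fanoutFn_mem_FP unLenF_mem_FP (mulF_mem_FP i))

/-- `blkF i ∈ FP`. -/
theorem blkF_mem_FP (i : ℕ) : blkF i ∈ FP :=
  comp_mem_FP takeFn_mem_FP (fanoutFn_mem_FP unLenF_mem_FP
    (comp_mem_FP dropFn_mem_FP (fanoutFn_mem_FP (mulF_mem_FP i) sndF_mem_FP)))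

variable {g S Bb}

/-- `imgF g j₀ i ∈ FP` for `g ∈ FP`. -/
theorem imgF_mem_FP (hg : g ∈ FP) (j₀ i : ℕ) : imgF g j₀ i ∈ FP := by
  unfold imgF
  split_ifs
  · exact imgInF_mem_FP
  · exact comp_mem_FP hg (blkF_mem_FP i)

/-- `flatF fs ∈ FP` for bricks `fs` in `FP`. -/
theorem flatF_mem_FP : ∀ {fs : List (List Bool → List Bool)}, (∀ f ∈ fs, f ∈ FP) → flatF fs ∈ FP
  | [], _ => const_mem_FP _
  | f :: fs, h => fanoutFn_mem_FP (h f (by simp)) (flatF_mem_FP fun f' hf' => h f' (by simp [hf']))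

/-- `imgsF g t j₀ ∈ FP` for `g ∈ FP`. -/
theorem imgsF_mem_FP (hg : g ∈ FP) (t j₀ : ℕ) : imgsF g t j₀ ∈ FP :=
  flatF_mem_FP fun f hf => by
    obtain ⟨i, rfl⟩ := List.mem_ofFn.1 hf
    exact imgF_mem_FP hg j₀ i

/-- `bitAtF i V ∈ FP` for `V ∈ FP`. -/
theorem bitAtF_mem_FP (i : ℕ) {V : List Bool → List Bool} (hV : V ∈ FP) : bitAtF i V ∈ FP :=
  comp_mem_FP eqPairFn_mem_FP (fanoutFn_mem_FP
    (comp_mem_FP takeFn_mem_FP (fanoutFn_mem_FP (const_mem_FP _)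
      (comp_mem_FP dropFn_mem_FP (fanoutFn_mem_FP (const_mem_FP _) hV)))) (const_mem_FP _))

/-- `wrongF Bb i V ∈ FP` for `Bb, V ∈ FP`. -/
theorem wrongF_mem_FP (hBb : Bb ∈ FP) (i : ℕ) {V : List Bool → List Bool} (hV : V ∈ FP) :
    wrongF Bb i V ∈ FP :=
  notFn_mem_FP (comp_mem_FP eqPairFn_mem_FP
    (fanoutFn_mem_FP (comp_mem_FP hBb (blkF_mem_FP i)) (bitAtF_mem_FP i hV)))

/-- `entryF i ∈ FP`. -/
theorem entryF_mem_FP (i : ℕ) : entryF i ∈ FP := fanoutFn_mem_FP (const_mem_FP _) (blkF_mem_FP i)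

/-- `selF Bb V l dd ∈ FP` for `Bb, V ∈ FP`. -/
theorem selF_mem_FP (hBb : Bb ∈ FP) {V : List Bool → List Bool} (hV : V ∈ FP) :
    ∀ (l : List ℕ) (dd : ℕ), selF Bb V l dd ∈ FP
  | [], dd => entryF_mem_FP dd
  | i :: is, dd => iteFn_mem_FP (wrongF_mem_FP hBb i hV) (entryF_mem_FP i) (selF_mem_FP hBb hV is dd)

/-- `allRightF Bb V l ∈ FP` for `Bb, V ∈ FP`. -/
theorem allRightF_mem_FP (hBb : Bb ∈ FP) {V : List Bool → List Bool} (hV : V ∈ FP) :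
    ∀ l : List ℕ, allRightF Bb V l ∈ FP
  | [] => const_mem_FP _
  | i :: is => andFn_mem_FP (notFn_mem_FP (wrongF_mem_FP hBb i hV)) (allRightF_mem_FP hBb hV is)

/-- Every entry brick is in `FP` (for `S, Bb, imgs ∈ FP`). -/
theorem entriesF_mem_FP (hS : S ∈ FP) (hBb : Bb ∈ FP) {cd : List ℕ} {dd : ℕ}
    {imgs : List Bool → List Bool} (hi : imgs ∈ FP) :
    ∀ r, ∀ f ∈ entriesF S Bb cd dd imgs r, f ∈ FP
  | 0, f, hf => by simp [entriesF] at hf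
  | r + 1, f, hf => by
    simp only [entriesF, List.mem_append, List.mem_singleton] at hf
    rcases hf with hf | rfl
    · exact entriesF_mem_FP hS hBb hi r f hf
    · exact selF_mem_FP hBb (comp_mem_FP hS (fanoutFn_mem_FP hi
        (flatF_mem_FP (entriesF_mem_FP hS hBb hi r)))) _ _

/-- `propF … r ∈ FP`. -/
theorem propF_mem_FP (hS : S ∈ FP) (hBb : Bb ∈ FP) {cd : List ℕ} {dd : ℕ}
    {imgs : List Bool → List Bool} (hi : imgs ∈ FP) (r : ℕ) : propF S Bb cd dd imgs r ∈ FP :=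
  comp_mem_FP hS (fanoutFn_mem_FP hi (flatF_mem_FP (entriesF_mem_FP hS hBb hi r)))

/-- `scanF … r m ∈ FP`: **the predictor's output brick is polynomial-time** (Arora–Barak 2009,
§1.3: closure of polynomial time under composition). -/
theorem scanF_mem_FP (hS : S ∈ FP) (hBb : Bb ∈ FP) {cd : List ℕ} {dd : ℕ}
    {imgs : List Bool → List Bool} (hi : imgs ∈ FP) (j₀ : ℕ) :
    ∀ m r, scanF S Bb cd dd imgs j₀ r m ∈ FP
  | 0, _ => const_mem_FP _
  | m + 1, r => iteFn_mem_FP (allRightF_mem_FP hBb (propF_mem_FP hS hBb hi r) cd)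
      (bitAtF_mem_FP j₀ (propF_mem_FP hS hBb hi r)) (scanF_mem_FP hS hBb hi j₀ m (r + 1))

/-! #### One-bit outputs -/

/-- An equality test outputs one bit. -/
private theorem oneBit_eqPairFn_comp (f : List Bool → List Bool) : OneBit (eqPairFn ∘ f) := fun w =>
  (eqPairFn_eq_or (f w)).elim (fun h => ⟨true, h⟩) fun h => ⟨false, h⟩

/-- `bitAtF` outputs one bit. -/
theorem oneBit_bitAtF (i : ℕ) (V : List Bool → List Bool) : OneBit (bitAtF i V) :=
  oneBit_eqPairFn_comp _

/-- `wrongF` outputs one bit. -/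
theorem oneBit_wrongF (i : ℕ) (V : List Bool → List Bool) : OneBit (wrongF Bb i V) :=
  oneBit_notFn (oneBit_eqPairFn_comp _)

/-- `allRightF` outputs one bit. -/
theorem oneBit_allRightF (V : List Bool → List Bool) : ∀ l : List ℕ, OneBit (allRightF Bb V l)
  | [] => oneBit_const true
  | i :: is => oneBit_andFn (oneBit_notFn (oneBit_wrongF i V)) (oneBit_allRightF V is)

/-- `scanF` outputs one bit. -/
theorem oneBit_scanF (cd : List ℕ) (dd : ℕ) (imgs : List Bool → List Bool) (j₀ : ℕ) :
    ∀ m r, OneBit (scanF S Bb cd dd imgs j₀ r m)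
  | 0, _ => oneBit_const false
  | m + 1, r => (oneBit_allRightF _ cd).ite (oneBit_bitAtF j₀ _) (oneBit_scanF cd dd imgs j₀ m (r + 1))

/-! #### Values on a well-formed machine input `⟨⟨1ⁿ, y⟩, r⟩` -/

/-- The machine input `⟨⟨1ⁿ, y⟩, r⟩` (input `⟨1ⁿ, y⟩` paired with the coins `r`). -/
def zIn (n : ℕ) (y r : List Bool) : List Bool := boolPair (boolPair (unaryEncodeNat n) y) r

/-- `|1ⁿ| = n`. -/
private theorem len_unary (n : ℕ) : (unaryEncodeNat n).length = n := unary_decode_encode_nat n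

variable (n : ℕ) (y r : List Bool)

/-- The input component of `zIn`. -/
@[simp] theorem fstF_zIn : fstF (zIn n y r) = boolPair (unaryEncodeNat n) y := by simp [zIn, fstF]

/-- The coin component of `zIn`. -/
@[simp] theorem sndF_zIn : sndF (zIn n y r) = r := by simp [zIn, sndF]

/-- `unLenF` reads `1ⁿ`. -/
@[simp] theorem unLenF_zIn : unLenF (zIn n y r) = unaryEncodeNat n := by simp [unLenF]

/-- `imgInF` reads `y`. -/
@[simp] theorem imgInF_zIn : imgInF (zIn n y r) = y := by simp [imgInF]

/-- `mulF i` computes `1^{i n}`. -/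
@[simp] theorem mulF_zIn : ∀ i, mulF i (zIn n y r) = unaryEncodeNat (i * n)
  | 0 => by simp [mulF]; rfl
  | i + 1 => by
    show (concatFn ∘ fanoutFn unLenF (mulF i)) (zIn n y r) = _
    rw [Function.comp_apply, fanoutFn_apply, unLenF_zIn, mulF_zIn i, concatFn_boolPair,
      OracleCompose.unaryEncodeNat_eq_replicate, OracleCompose.unaryEncodeNat_eq_replicate,
      OracleCompose.unaryEncodeNat_eq_replicate, List.replicate_append_replicate, add_mul, one_mul,
      add_comm]

/-- `blkF i` reads block `i` of the coins. -/
@[simp] theorem blkF_zIn (i : ℕ) : blkF i (zIn n y r) = chunk n r i := by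
  simp [blkF, chunk, len_unary, mul_comm]

/-- `flatF` is the brick form of `flat`. -/
theorem flatF_apply : ∀ (fs : List (List Bool → List Bool)) (w : List Bool),
    flatF fs w = flat (fs.map fun f => f w)
  | [], _ => rfl
  | f :: fs, w => by simp only [flatF, fanoutFn_apply, flatF_apply fs w, List.map_cons, flat]

/-- Value of the image brick `imgF`. -/
@[simp] theorem imgF_zIn (j₀ i : ℕ) :
    imgF g j₀ i (zIn n y r) = if i = j₀ then y else g (chunk n r i) := by
  unfold imgF; split_ifs <;> simp

/-- Value of the images brick `imgsF`. -/
theorem imgsF_zIn (t j₀ : ℕ) :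
    imgsF g t j₀ (zIn n y r) = flat (List.ofFn fun i : Fin t => if (i : ℕ) = j₀ then y else g (chunk n r i)) := by
  rw [imgsF, flatF_apply, List.map_ofFn]
  exact congrArg flat (congrArg List.ofFn (funext fun i => by simp [Function.comp_apply]))

/-- The first bit of `l ⇂ i` read as in `bitAtF` is `l.getD i false`. -/
private theorem decide_take_one_drop (l : List Bool) (i : ℕ) :
    decide ((l.drop i).take 1 = [true]) = l.getD i false := by
  rw [List.getD_eq_getElem?_getD, ← List.head?_drop]
  cases l.drop i with
  | nil => simp
  | cons a m => cases a <;> simp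

/-- `bitAtF i V` computes bit `i` of `V`'s value. -/
theorem bitAtF_apply (i : ℕ) (V : List Bool → List Bool) (w : List Bool) :
    bitAtF i V w = [(V w).getD i false] := by
  simp only [bitAtF, Function.comp_apply, fanoutFn_apply, dropFn_boolPair, len_unary,
    takeFn_boolPair, List.length_singleton, eqPairFn_boolPair, decide_take_one_drop]

variable {B} in
/-- `wrongF Bb i V` tests whether coordinate `i` of `V`'s value is wrong for block `i`. -/
theorem wrongF_zIn (hBb : ∀ w, Bb w = [B w]) (i : ℕ) (V : List Bool → List Bool) :
    wrongF Bb i V (zIn n y r) = [decide (B (chunk n r i) ≠ (V (zIn n y r)).getD i false)] := by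
  have h1 : (eqPairFn ∘ fanoutFn (Bb ∘ blkF i) (bitAtF i V)) (zIn n y r) =
      [decide (B (chunk n r i) = (V (zIn n y r)).getD i false)] := by
    simp only [Function.comp_apply, fanoutFn_apply, blkF_zIn, hBb, bitAtF_apply, eqPairFn_boolPair,
      List.cons.injEq, and_true]
  rw [wrongF, notFn_apply h1]
  simp only [decide_not]

/-- Value of the entry brick `entryF`. -/
@[simp] theorem entryF_zIn (i : ℕ) : entryF i (zIn n y r) = boolPair (unaryEncodeNat i) (chunk n r i) := by
  simp [entryF]

variable {B} in
/-- `selF` reveals the entry of the first wrong listed coordinate. -/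
theorem selF_zIn (hBb : ∀ w, Bb w = [B w]) (V : List Bool → List Bool) : ∀ (l : List ℕ) (dd : ℕ),
    selF Bb V l dd (zIn n y r) =
      entryF (firstSat (fun i => B (chunk n r i) ≠ (V (zIn n y r)).getD i false) l dd) (zIn n y r)
  | [], _ => rfl
  | i :: is, dd => by
    rw [selF, iteFn_apply (wrongF_zIn n y r hBb i V), firstSat]
    by_cases h : B (chunk n r i) ≠ (V (zIn n y r)).getD i false
    · rw [decide_eq_true h, if_pos rfl, if_pos h]
    · rw [decide_eq_false h, if_neg Bool.false_ne_true, if_neg h, selF_zIn hBb V is dd]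

variable {B} in
/-- `allRightF` tests that all listed coordinates are right. -/
theorem allRightF_zIn (hBb : ∀ w, Bb w = [B w]) (V : List Bool → List Bool) : ∀ l : List ℕ,
    allRightF Bb V l (zIn n y r) =
      [decide (∀ i ∈ l, ¬ (B (chunk n r i) ≠ (V (zIn n y r)).getD i false))]
  | [] => by simp [allRightF]
  | i :: is => by
    rw [allRightF, andFn_apply (notFn_apply (wrongF_zIn n y r hBb i V)) (allRightF_zIn hBb V is)]
    simp only [List.forall_mem_cons, Bool.decide_and, decide_not, Bool.not_not]

end Bricks

end StubGame

/-- **Flattening finitely many `FP` bricks is an `FP` brick** (explicit-binder form, registered sub-goal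
`stubGame_flatF_mem_FP` of stmt-PneNP-10709). -/
theorem stubGame_flatF_mem_FP (fs : List (List Bool → List Bool)) (h : ∀ f ∈ fs, f ∈ FP) :
    StubGame.flatF fs ∈ FP :=
  StubGame.flatF_mem_FP h

end Summit.PneNP.PneNP.Theorems.LatticeMagicTarget
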